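import Summits.BirchSwinnertonDyer.BirchSwinnertonDyer.Theorems.SylvesterTwoHeegnerIndexCMHalfInvolutionFixingBottomOfLevel
import HarnessLib

/-!
# PLANNER SKETCH (bsd-cm-plan g29, NOT a proposal, NOT a skeleton; `lean check` rc 0, 0 sorries): the two support nodes of ASKS (ρ2′)/(ρ3) and the certified
# one-line reductions of items 19804 / 19802 they buy (for the tenure / director; planner files no `route edit`, D146).
-/

set_option linter.dupNamespace false
set_option autoImplicit false

noncomputable section

open scoped Classical Pointwise

namespace Summit.BirchSwinnertonDyer.BirchSwinnertonDyer.Theses.SylvesterTwoHeegnerIndex.ReglueSketch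

open WeierstrassCurve Field NumberField IsDedekindDomain IsDedekindDomain.HeightOneSpectrum Finset Module
open Literature.NumberTheory.EllipticCurves Literature.NumberTheory.GaloisRepresentations
  Literature.NumberTheory.EllipticCurves.ModularForms
  Literature.NumberTheory.EllipticCurves.HuShuYin2019
  Literature.NumberTheory.EllipticCurves.KolyvaginCocycle
  Literature.NumberTheory.EllipticCurves.RingClassField
  Summit.BirchSwinnertonDyer.BirchSwinnertonDyer.Theses.SylvesterTwoHeegnerIndex
  Summit.BirchSwinnertonDyer.BirchSwinnertonDyer.Theorems
  Summit.BirchSwinnertonDyer.BirchSwinnertonDyer.Theorems.SylvesterTwoCoupledDescentCebotarev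
  Summit.BirchSwinnertonDyer.BirchSwinnertonDyer.Theorems.SylvesterTwoCMData
  Summit.BirchSwinnertonDyer.BirchSwinnertonDyer.Theorems.SylvesterTwoCMFlip
  Summit.BirchSwinnertonDyer.Rank1Residual.X11b Summit.BirchSwinnertonDyer.Rank1Residual.X11b.RingClassTower


open Summit.BirchSwinnertonDyer.BirchSwinnertonDyer.Theorems.SylvesterTwoCMHalf

/-- support (ρ2′): the three PRINT inputs of the halved chain — a degree-6 modular parametrisation datum of
`X₀(243) → 243b`, Hu–Shu–Yin's named height identity (#19) and Nekovář's CM-point Frobenius congruence (#20). -/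
def PublishedInputsKolyvaginTwo : Prop :=
  (∃ Dt : ModularParametrizationData (⟨0, 0, 1, 0, -1⟩ : WeierstrassCurve ℚ) 243, Dt.deg = 6) ∧
    shaAnPair_mul_height_eq_two_zpow_mul_height_named ∧ Nekovar2007.cmPoint_frobeniusCongruence

/-- support (ρ3): the pure (W2-b) lemma (memo two §67.2) — at the place above 3, every decomposition involution of
`Gal(K[9pn]/K)` fixes Hu–Shu–Yin's CM point of Kolyvagin level `n` (p691380 `hW2b`, l.174–187, verbatim). -/
def TowerFixingSevenModNine : Prop :=
  ∀ Dt : ModularParametrizationData (⟨0, 0, 1, 0, -1⟩ : WeierstrassCurve ℚ) 243, Dt.deg = 6 →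
     ∀ (p : ℕ), p.Prime → p % 9 = 7 → ∀ (K : Type) [Field K] [NumberField K] (ω : K), ω ^ 2 + ω + 1 = 0 →
      Module.finrank ℚ K = 2 → ∀ (ι : K →+* ℂ) (v : HeightOneSpectrum (𝓞 K)), ((3 : ℕ) : 𝓞 K) ∈ v.asIdeal →
      ∀ (n : ℕ), n ≠ 0 → (∀ q ∈ n.primeFactors, q % 3 = 2) →
      ∀ (e : ringClassField K ι (9 * p * n) →+* AlgebraicClosure K),
        (∀ k : K, e (algebraMap K (ringClassField K ι (9 * p * n)) k) = algebraMap K (AlgebraicClosure K) k) →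
      ∀ (y : ((⟨0, 0, 1, 0, -1⟩ : WeierstrassCurve ℚ).baseChange (ringClassField K ι (9 * p * n))).toAffine.Point),
        Affine.Point.map (W' := (⟨0, 0, 1, 0, -1⟩ : WeierstrassCurve ℚ)) (ringClassField K ι (9 * p * n)).subtype.toRatAlgHom y =
          Dt.φ (heegnerTau ((n : ℤ) ^ 2 * (81 * ((p : ℤ) ^ 2 + 4 * p + 16)),
            (n : ℤ) * (-(9 * (4 * (p : ℤ) ^ 2 + 17 * p + 72))), 4 * (p : ℤ) ^ 2 + 18 * p + 81)) →
      ∀ (τ : absoluteGaloisGroup (v.adicCompletion K))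
        (φ : ringClassField K ι (9 * p * n) ≃ₐ[K] ringClassField K ι (9 * p * n)),
        (∀ x : ringClassField K ι (9 * p * n), (show AlgebraicClosure K ≃ₐ[K] AlgebraicClosure K from
          resGal (K := K) (v.adicCompletion K) τ) (e x) = e (φ x)) → φ * φ = 1 →
        pointGalHom (⟨0, 0, 1, 0, -1⟩ : WeierstrassCurve ℚ) (ringClassField K ι (9 * p * n)) (φ.restrictScalars ℚ) y = y

/-- With (ρ2′) and (ρ3) glued, item 19804's decl reduces to the two TAIL stubs (types verbatim from VARIANT M). -/
theorem upperOffV0HSYPlus_of_nodes (hPI : PublishedInputsKolyvaginTwo) (hTF : TowerFixingSevenModNine)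
    (htailFour : PublishedFactsTwoPlus →
    ∀ (p : ℕ), p.Prime → p % 9 = 4 → (¬ ∃ x : ZMod p, x ^ 3 = 3) →
      ∀ (A B : WeierstrassCurve ℚ) [A.IsElliptic] [A.IsGloballyMinimal] [B.IsElliptic]
        [B.IsGloballyMinimal], (∃ C : VariableChange ℚ, C • B = HuShuYin2019.cubeSumCurve (p : ℚ)) →
        (∃ C : VariableChange ℚ, C • A = HuShuYin2019.cubeSumCurve (3 * (p : ℚ) ^ 2)) →
        4 < Nat.card (AddCommGroup.primaryComponent B.sha 2) *
            Nat.card (AddCommGroup.primaryComponent A.sha 2) →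
        ∃ qB qA : ℚ, shaAn B = (qB : ℂ) ∧ shaAn A = (qA : ℂ) ∧ qB * qA ≠ 0 ∧
          (padicValNat 2 (Nat.card (AddCommGroup.primaryComponent B.sha 2)) : ℤ) +
              (padicValNat 2 (Nat.card (AddCommGroup.primaryComponent A.sha 2)) : ℤ) ≤
            padicValRat 2 (qB * qA))
    (htailSeven : PublishedFactsTwoPlus →
    ∀ (p : ℕ), p.Prime → p % 9 = 7 → (¬ ∃ x : ZMod p, x ^ 3 = 3) →
      ∀ (A B : WeierstrassCurve ℚ) [A.IsElliptic] [A.IsGloballyMinimal] [B.IsElliptic]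
        [B.IsGloballyMinimal], (∃ C : VariableChange ℚ, C • B = HuShuYin2019.cubeSumCurve (p : ℚ)) →
        (∃ C : VariableChange ℚ, C • A = HuShuYin2019.cubeSumCurve (3 * (p : ℚ) ^ 2)) →
        4 < Nat.card (AddCommGroup.primaryComponent B.sha 2) *
            Nat.card (AddCommGroup.primaryComponent A.sha 2) →
        ∃ qB qA : ℚ, shaAn B = (qB : ℂ) ∧ shaAn A = (qA : ℂ) ∧ qB * qA ≠ 0 ∧
          (padicValNat 2 (Nat.card (AddCommGroup.primaryComponent B.sha 2)) : ℤ) +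
              (padicValNat 2 (Nat.card (AddCommGroup.primaryComponent A.sha 2)) : ℤ) ≤
            padicValRat 2 (qB * qA)) :
    Summit.BirchSwinnertonDyer.BirchSwinnertonDyer.Theses.SylvesterTwoHeegnerIndex.UpperOffV0HSYPlus := by
  obtain ⟨⟨Dt, hdeg⟩, hD, hES2⟩ := hPI
  exact upperOffV0HSYPlus_of_named_of_flip_of_involutionFixing_of_tails Dt hdeg hD hES2
    (involutionFixing_bottom_of_level Dt (hTF Dt hdeg)) (hTF Dt hdeg) htailFour htailSeven

/-- With (ρ2′) and (ρ3) glued, item 19802's decl closes (its own `hH` = Hu–Shu–Yin's display (bsd), un-named twin). -/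
theorem hsyPointTwoDivisibleSevenModNine_of_nodes (hPI : PublishedInputsKolyvaginTwo) (hTF : TowerFixingSevenModNine)
    (hH : shaAnPair_mul_height_eq_two_zpow_mul_height) :
    Summit.BirchSwinnertonDyer.BirchSwinnertonDyer.Theses.SylvesterTwoHeegnerIndex.HSYPointTwoDivisibleSevenModNine := by
  obtain ⟨⟨Dt, hdeg⟩, hD, -⟩ := hPI
  exact theses_hsyPointTwoDivisibleSevenModNine_of_named_of_involutionFixing Dt hdeg hD hH
    (involutionFixing_bottom_of_level Dt (hTF Dt hdeg))

end Summit.BirchSwinnertonDyer.BirchSwinnertonDyer.Theses.SylvesterTwoHeegnerIndex.ReglueSketch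

end
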